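import Summits.CriticalPhenomena.SAWScalingLimit.Theorems.SAWDefectDecoherenceObservableToSLERCarvedReductionSqueezeTwoPiecePush
import HarnessLib

/-!
# Two-piece flat domains: the exterior escape routes of the admissible lattice families
# (piece (G4′b) of stub 5a4′ `stub_carvedReduction_squeeze`)

Piece of stub 5a4′ `stub_carvedReduction_squeeze` (`TwoPieceAdmRestrictionLimit → MovingCarvingSqueeze`)
of the line `bridge-gate-renewal` (r9) of the crux `SAWDefectDecoherence.ObservableToSLER`
(stmt-CriticalPhenomena-14005; twin T2b′/T2b″ of stmt-CriticalPhenomena-10472), item (G4′):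
ADMISSIBLE LATTICE FAMILIES OF A TWO-PIECE FLAT DOMAIN.  Both `MovingCarvingSqueeze` (for the fixed
inner domain `M`) and every application of ARL″ (`TwoPieceAdmRestrictionLimit`, for the pairs
outer approximant / inner domain) ask for vertex domains `Λ δ` which are simply connected and
connected, lie inside the domain, have EXACT rows `{row ≥ mᵢ δ}` in balls about the two marked
points, prescribed vertical gate mid-edges, and exhaust the compacts.  The floor line's tools
(`FloorRatio.exists_innerFamily` and its companions, crux 10472) do this for FLOOR domains
`Ω ⊆ {im > h}` with both marked points on the line `im = h`; the squeeze needs it for a general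
bounded domain with connected exterior which is flat (an exact upper half-disc) in the `ρ`-balls
about two boundary points `p 0`, `p 1` at DIFFERENT heights, with PRESCRIBED threshold rows
`m i` (at the un-pinned end the translated gate row may sit many rows above the natural one).

This file is the continuum-to-lattice input of that construction, the ESCAPE ROUTES through the
exterior `(closure Ω)ᶜ`.  The deep vertices `S` at mesh `δ` are: `δ c_u ∈ Ω`, row `≥ m i δ` inside
`B(p i, ρ/2)`, and the closed `70δ`-disc about `δ c_u` inside `Ω ∪ B(p 0, 5ρ/8) ∪ B(p 1, 5ρ/8)`
(the absorbing discs let the exact rows reach the flat boundary pieces).  An exterior path may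
skim the flat pieces from below, next to deep vertices; it is first pushed down, inside the two
windows only, by the continuous map `exists_pushDown` of `…SqueezeTwoPiecePush` (piece (G4′a)):

* `exists_pathIn_far_of_low` — THE LOW ROUTE: from any exterior point which is not in the upper
  part `{im > im (p i) - ρ/8}` of a window box, every lattice vertex within `2δ` is joined,
  avoiding `S`, to a vertex of norm `≥ R + ρ + 5δ` (`‖·‖ < R` on `Ω`);
* `exists_pathIn_far_of_not_mem` — every vertex with `δ c_v ∉ Ω` escapes (descend below the
  window if under one, then the low route);
* `exists_pathIn_far_of_row_lt` — every vertex of `B(p i, ρ/16)` of row `< m i δ` escapes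
  (descend inside the window, then the low route).

Sources: H. Duminil-Copin, S. Smirnov, Ann. of Math. 175 (2012) §3 (discrete domains
approximating a flat boundary piece); G. F. Lawler, O. Schramm, W. Werner, Proc. Sympos. Pure
Math. 72 (2004) §3.4.
-/

noncomputable section

open scoped Topology
open Filter Set Metric
open Literature.Probability.LatticeModels (HexVertex hexGraph hexCenter Site)
open Literature.Probability.RandomPlanarGeometry
open Literature.Probability.RandomPlanarGeometry.SAW
open Literature.Probability.Percolation (PathIn)

namespace Summit.CriticalPhenomena.SAWScalingLimit.Theorems.ObservableToSLER.Squeeze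

open Summit.CriticalPhenomena.SAWScalingLimit.Theorems.ObservableToSLE.FloorRatio

/-! ### The low route through the exterior -/

/-- **THE LOW ROUTE.**  Let `Ω` be bounded (`‖·‖ < R` on `Ω`) with connected exterior
`(closure Ω)ᶜ`, flat in the `ρ`-balls about `p 0`, `p 1` (`dist (p 0) (p 1) ≥ 2ρ`), and let the
`70δ`-discs about the vertices of `S` (all with `δ c_u ∈ Ω`) lie in
`Ω ∪ B(p 0, 5ρ/8) ∪ B(p 1, 5ρ/8)`.  Then from every exterior point `e` which, if within `7ρ/10`
of a window centre `p i`, lies at height `≤ im (p i) - ρ/8`, every lattice vertex within `2δ` of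
`e` is joined OUTSIDE `S` to a vertex of norm `≥ R + ρ + 5δ`.  (Push the exterior down inside the
two window boxes by a continuous map of the plane — by `31δ` right under the flat pieces — so that
exterior points absorbed by a disc `B(p j, 5ρ/8)` are at height `≤ im (p j) - 30δ`; follow the
pushed image of an exterior path from `e` to the far point `R + ρ + 8δ` by a lattice walk within
`8δ` of it: a deep vertex that close would lie in `Ω` inside the window, above the line, yet
below height `im (p j) - 22δ`.) -/
theorem exists_pathIn_far_of_low {Ω : Set ℂ} {ρ δ R : ℝ} {p : Fin 2 → ℂ} {S : Set HexVertex}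
    (hE : IsConnected (closure Ω)ᶜ) (hΩR : ∀ z ∈ Ω, ‖z‖ < R)
    (hfl : ∀ i, Ω ∩ ball (p i) ρ = {z : ℂ | (p i).im < z.im} ∩ ball (p i) ρ)
    (hsep : 2 * ρ ≤ dist (p 0) (p 1)) (hρ : 0 < ρ) (hδ : 0 < δ) (hδρ : 1000 * δ ≤ ρ)
    (hS : ∀ u ∈ S, (δ : ℂ) * hexCenter u ∈ Ω ∧
      closedBall ((δ : ℂ) * hexCenter u) (70 * δ) ⊆ Ω ∪ ball (p 0) (5 * ρ / 8) ∪ ball (p 1) (5 * ρ / 8))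
    {e : ℂ} (he : e ∈ (closure Ω)ᶜ)
    (helow : ∀ i, dist e (p i) < 7 * ρ / 10 → e.im ≤ (p i).im - ρ / 8)
    {z₁ : HexVertex} (hz₁ : dist ((δ : ℂ) * hexCenter z₁) e ≤ 2 * δ) :
    ∃ w : HexVertex, R + ρ + 5 * δ ≤ ‖(δ : ℂ) * hexCenter w‖ ∧ PathIn hexGraph Sᶜ z₁ w := by
  have hR : 0 ≤ R := by
    have hc := center_mem_closure_of_flat hρ (hfl 0)
    obtain ⟨z, hz, -⟩ := Metric.mem_closure_iff.1 hc 1 one_pos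
    exact (norm_nonneg z).trans (hΩR z hz).le
  -- closure Ω and the window centres lie in the closed `R`-disc
  have hclR : closure Ω ⊆ closedBall (0 : ℂ) R :=
    closure_minimal (fun z hz => mem_closedBall_zero_iff.2 (hΩR z hz).le) isClosed_closedBall
  have hpR : ∀ i, ‖p i‖ ≤ R := fun i =>
    mem_closedBall_zero_iff.1 (hclR (center_mem_closure_of_flat hρ (hfl i)))
  obtain ⟨Pd, hPdc, hPdE, hfix, hPdslab⟩ := exists_pushDown hfl hsep hρ hδ hδρ
  have hPde : Pd e = e := hfix e helow
  set q : ℂ := ((R + ρ + 8 * δ : ℝ) : ℂ) with hq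
  have hqnorm : ‖q‖ = R + ρ + 8 * δ := by
    rw [hq, Complex.norm_real, Real.norm_of_nonneg (by positivity)]
  have hqfar : ∀ i, 7 * ρ / 10 ≤ dist q (p i) := by
    intro i
    have h1 : ‖q‖ - ‖p i‖ ≤ dist q (p i) := by
      rw [dist_eq_norm]; exact norm_sub_norm_le _ _
    have := hpR i
    linarith
  have hPdq : Pd q = q := hfix q fun i hi => absurd hi (not_lt.2 (hqfar i))
  have hqE : q ∉ closure Ω := fun h => by
    have := mem_closedBall_zero_iff.1 (hclR h)
    linarith
  -- an exterior path from `e` to `q`, pushed down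
  have hEo : IsOpen (closure Ω)ᶜ := isClosed_closure.isOpen_compl
  have hpc : IsPathConnected (closure Ω)ᶜ := hEo.isConnected_iff_isPathConnected.1 hE
  have hJ : JoinedIn (closure Ω)ᶜ e q := hpc.joinedIn e he q hqE
  set γ : Path e q := hJ.somePath with hγ
  set P : Set ℂ := (Pd ∘ γ) '' univ with hP
  have hPconn : IsPreconnected P :=
    isPreconnected_univ.image _ (hPdc.comp γ.continuous).continuousOn
  have heP : e ∈ P := ⟨0, mem_univ _, by simp [hPde]⟩
  have hqP : q ∈ P := ⟨1, mem_univ _, by simp [hPdq]⟩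
  have hPE : ∀ y ∈ P, y ∉ closure Ω := by
    rintro _ ⟨t, -, rfl⟩
    exact hPdE _ (hJ.somePath_mem t)
  have hPslab : ∀ y ∈ P, ∀ j, y ∈ ball (p j) (5 * ρ / 8) → y.im ≤ (p j).im - 30 * δ := by
    rintro _ ⟨t, -, rfl⟩ j hj
    exact hPdslab _ (hJ.somePath_mem t) j hj
  -- the far vertex and the lattice walk along the pushed path
  obtain ⟨z₂, hz₂⟩ := exists_vertex_dist_le hδ q
  have hz₂far : R + ρ + 5 * δ ≤ ‖(δ : ℂ) * hexCenter z₂‖ := by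
    have h1 : ‖q‖ - ‖(δ : ℂ) * hexCenter z₂‖ ≤ dist ((δ : ℂ) * hexCenter z₂) q := by
      rw [dist_comm, dist_eq_norm]; exact norm_sub_norm_le _ _
    linarith
  obtain ⟨pw, hpw⟩ := exists_walk_near_of_isPreconnected hPconn hδ (r := 2 * δ) (by linarith)
    heP hqP hz₁ (hz₂.trans (by linarith))
  refine ⟨z₂, hz₂far, pathIn_of_walk pw fun u hu huS => ?_⟩
  obtain ⟨y, hyP, hdy⟩ := hpw u hu
  obtain ⟨huΩ, hball⟩ := hS u huS
  have hyball : y ∈ closedBall ((δ : ℂ) * hexCenter u) (70 * δ) := by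
    rw [mem_closedBall, dist_comm]; linarith
  have hyΩ : y ∉ Ω := fun h => hPE y hyP (subset_closure h)
  -- the exterior point `y` is absorbed by a window disc `B(p j, 5ρ/8)`
  obtain ⟨j, hj⟩ : ∃ j, y ∈ ball (p j) (5 * ρ / 8) := by
    rcases hball hyball with (h | h) | h
    · exact absurd h hyΩ
    · exact ⟨0, h⟩
    · exact ⟨1, h⟩
  have hyim : y.im ≤ (p j).im - 30 * δ := hPslab y hyP j hj
  have huball : (δ : ℂ) * hexCenter u ∈ ball (p j) ρ := by
    rw [mem_ball]
    calc dist ((δ : ℂ) * hexCenter u) (p j) ≤ dist ((δ : ℂ) * hexCenter u) y + dist y (p j) :=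
          dist_triangle _ _ _
      _ < 4 * (2 * δ) + 5 * ρ / 8 := add_lt_add hdy (mem_ball.1 hj)
      _ ≤ ρ := by linarith
  have huim : (p j).im < ((δ : ℂ) * hexCenter u).im := im_lt_of_flat (hfl j) huball huΩ
  have h1 : ((δ : ℂ) * hexCenter u).im - y.im ≤ dist ((δ : ℂ) * hexCenter u) y := by
    rw [dist_eq_norm, ← Complex.sub_im]; exact Complex.im_le_norm _
  linarith

/-! ### Escape of the vertices outside the domain and of the low rows near the windows -/

/-- **Vertices outside `Ω` escape.**  In the setting of `exists_pathIn_far_of_low`, with the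
exterior's frontier equal to `∂Ω` (Jordan domains), every vertex `v` with `δ c_v ∉ Ω` is joined
outside `S` to a vertex of norm `≥ R + ρ + 5δ`: under a window first descend below height
`im (p i) - ρ/8` (inside the window, below the line, hence off `Ω ⊇ S`), then take the low route
(from the point reached, or from an exterior point next to `δ c_v`). -/
theorem exists_pathIn_far_of_not_mem {Ω : Set ℂ} {ρ δ R : ℝ} {p : Fin 2 → ℂ} {S : Set HexVertex}
    (hE : IsConnected (closure Ω)ᶜ) (hEfr : frontier (closure Ω)ᶜ = frontier Ω)
    (hΩR : ∀ z ∈ Ω, ‖z‖ < R)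
    (hfl : ∀ i, Ω ∩ ball (p i) ρ = {z : ℂ | (p i).im < z.im} ∩ ball (p i) ρ)
    (hsep : 2 * ρ ≤ dist (p 0) (p 1)) (hρ : 0 < ρ) (hδ : 0 < δ) (hδρ : 1000 * δ ≤ ρ)
    (hS : ∀ u ∈ S, (δ : ℂ) * hexCenter u ∈ Ω ∧
      closedBall ((δ : ℂ) * hexCenter u) (70 * δ) ⊆ Ω ∪ ball (p 0) (5 * ρ / 8) ∪ ball (p 1) (5 * ρ / 8))
    {v : HexVertex} (hv : (δ : ℂ) * hexCenter v ∉ Ω) :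
    ∃ w : HexVertex, R + ρ + 5 * δ ≤ ‖(δ : ℂ) * hexCenter w‖ ∧ PathIn hexGraph Sᶜ v w := by
  -- distinct window centres are `2ρ` apart
  have hsep' : ∀ i j : Fin 2, i ≠ j → 2 * ρ ≤ dist (p i) (p j) := by
    intro i j hij
    fin_cases i <;> fin_cases j
    · exact absurd rfl hij
    · exact hsep
    · rw [dist_comm]; exact hsep
    · exact absurd rfl hij
  -- the low condition at a point of a window below height `im (p i) - ρ/8`
  have hlow_of : ∀ (e : ℂ) (i : Fin 2), dist e (p i) < ρ → e.im ≤ (p i).im - ρ / 8 →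
      ∀ j, dist e (p j) < 7 * ρ / 10 → e.im ≤ (p j).im - ρ / 8 := by
    intro e i hei heim j hej
    by_cases hij : i = j
    · subst hij; exact heim
    · exfalso
      have := hsep' i j hij
      have : dist (p i) (p j) ≤ dist e (p i) + dist e (p j) := dist_triangle_left _ _ _
      linarith
  by_cases hnear : ∃ i, dist ((δ : ℂ) * hexCenter v) (p i) < 3 * ρ / 4 - 3 * δ
  · obtain ⟨i, hi⟩ := hnear
    have hvball : (δ : ℂ) * hexCenter v ∈ ball (p i) ρ := mem_ball.2 (hi.trans (by linarith))
    have hvim : ((δ : ℂ) * hexCenter v).im ≤ (p i).im := by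
      by_contra hgt
      push Not at hgt
      have : (δ : ℂ) * hexCenter v ∈ {z : ℂ | (p i).im < z.im} ∩ ball (p i) ρ := ⟨hgt, hvball⟩
      rw [← hfl i] at this
      exact hv this.1
    rcases le_or_gt (((δ : ℂ) * hexCenter v).im) ((p i).im - ρ / 8) with hle | hgt
    · -- already low: the low route from `δ c_v` itself
      have heE : (δ : ℂ) * hexCenter v ∉ closure Ω :=
        not_mem_closure_of_flat (hfl i) hvball (by linarith)
      exact exists_pathIn_far_of_low hE hΩR hfl hsep hρ hδ hδρ hS heE
        (hlow_of _ i (mem_ball.1 hvball) hle) (z₁ := v) (by rw [dist_self]; positivity)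
    · -- descend below height `im (p i) - ρ/8` inside the window
      set L : ℝ := ((δ : ℂ) * hexCenter v).im - ((p i).im - ρ / 8) + δ with hL
      have hL0 : 0 ≤ L := by rw [hL]; linarith
      have hLle : L ≤ ρ / 8 + δ := by rw [hL]; linarith
      obtain ⟨w₀, q, hw₀, hq⟩ := exists_walk_down hδ v hL0
      have hw₀im : ((δ : ℂ) * hexCenter w₀).im ≤ (p i).im - ρ / 8 := by rw [hL] at hw₀; linarith
      have hmem : ∀ u ∈ q.support, (δ : ℂ) * hexCenter u ∈ ball (p i) ρ ∧
          ((δ : ℂ) * hexCenter u).im ≤ (p i).im := by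
        intro u hu
        obtain ⟨h1, h2⟩ := hq u hu
        refine ⟨mem_ball.2 ?_, h1.trans hvim⟩
        calc dist ((δ : ℂ) * hexCenter u) (p i)
            ≤ dist ((δ : ℂ) * hexCenter u) ((δ : ℂ) * hexCenter v) + dist ((δ : ℂ) * hexCenter v) (p i) :=
              dist_triangle _ _ _
          _ < 2 * L + (3 * ρ / 4 - 3 * δ) := add_lt_add_of_le_of_lt h2 hi
          _ ≤ ρ := by linarith
      have hvw₀ : PathIn hexGraph Sᶜ v w₀ := by
        refine pathIn_of_walk q fun u hu huS => ?_
        obtain ⟨hub, huim⟩ := hmem u hu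
        have := im_lt_of_flat (hfl i) hub (hS u huS).1
        linarith
      obtain ⟨hw₀b, -⟩ := hmem w₀ q.end_mem_support
      have heE : (δ : ℂ) * hexCenter w₀ ∉ closure Ω :=
        not_mem_closure_of_flat (hfl i) hw₀b (by linarith)
      obtain ⟨w, hw, hp⟩ := exists_pathIn_far_of_low hE hΩR hfl hsep hρ hδ hδρ hS heE
        (hlow_of _ i (mem_ball.1 hw₀b) hw₀im) (z₁ := w₀) (by rw [dist_self]; positivity)
      exact ⟨w, hw, hvw₀.trans hp⟩
  · -- far from both windows: the low route from an exterior point next to `δ c_v`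
    push Not at hnear
    obtain ⟨e, heE, hed⟩ := exists_mem_compl_closure_near hEfr hv hδ
    refine exists_pathIn_far_of_low hE hΩR hfl hsep hρ hδ hδρ hS heE (fun j hj => ?_) (z₁ := v)
      (by rw [dist_comm]; linarith)
    exfalso
    have := hnear j
    have : dist ((δ : ℂ) * hexCenter v) (p j) ≤ dist e ((δ : ℂ) * hexCenter v) + dist e (p j) :=
      dist_triangle_left _ _ _
    linarith

/-- **Low rows near a window escape.**  In the same setting, if moreover the vertices of `S`
inside `B(p i, ρ/2)` have row `≥ m i` and the up-faces of row `m i` sit at height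
`≤ im (p i) + ρ/16`, then every vertex of `B(p i, ρ/16)` of row `< m i` is joined outside `S` to
a vertex of norm `≥ R + ρ + 5δ` (descend below height `im (p i) - ρ/8` inside `B(p i, ρ/2)` —
the deep vertices met there are at least as high as the up-faces of row `m i`, i.e. higher than
the starting vertex — then the low route). -/
theorem exists_pathIn_far_of_row_lt {Ω : Set ℂ} {ρ δ R : ℝ} {p : Fin 2 → ℂ} {m : Fin 2 → ℤ}
    {S : Set HexVertex}
    (hE : IsConnected (closure Ω)ᶜ) (hEfr : frontier (closure Ω)ᶜ = frontier Ω)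
    (hΩR : ∀ z ∈ Ω, ‖z‖ < R)
    (hfl : ∀ i, Ω ∩ ball (p i) ρ = {z : ℂ | (p i).im < z.im} ∩ ball (p i) ρ)
    (hsep : 2 * ρ ≤ dist (p 0) (p 1)) (hρ : 0 < ρ) (hδ : 0 < δ) (hδρ : 1000 * δ ≤ ρ)
    (hm : ∀ i, ((m i : ℝ) + 1 / 3) * (δ * (Real.sqrt 3 / 2)) ≤ (p i).im + ρ / 16)
    (hS : ∀ u ∈ S, (δ : ℂ) * hexCenter u ∈ Ω ∧
      closedBall ((δ : ℂ) * hexCenter u) (70 * δ) ⊆ Ω ∪ ball (p 0) (5 * ρ / 8) ∪ ball (p 1) (5 * ρ / 8))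
    (hSrow : ∀ u ∈ S, ∀ i, (δ : ℂ) * hexCenter u ∈ ball (p i) (ρ / 2) → m i ≤ u.1 1)
    {v : HexVertex} {i : Fin 2} (hvi : dist ((δ : ℂ) * hexCenter v) (p i) < ρ / 16)
    (hrow : v.1 1 < m i) :
    ∃ w : HexVertex, R + ρ + 5 * δ ≤ ‖(δ : ℂ) * hexCenter w‖ ∧ PathIn hexGraph Sᶜ v w := by
  by_cases hvΩ : (δ : ℂ) * hexCenter v ∈ Ω
  swap
  · exact exists_pathIn_far_of_not_mem hE hEfr hΩR hfl hsep hρ hδ hδρ hS hvΩ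
  have hsep' : ∀ i j : Fin 2, i ≠ j → 2 * ρ ≤ dist (p i) (p j) := by
    intro i j hij
    fin_cases i <;> fin_cases j
    · exact absurd rfl hij
    · exact hsep
    · rw [dist_comm]; exact hsep
    · exact absurd rfl hij
  have hvball : (δ : ℂ) * hexCenter v ∈ ball (p i) ρ := mem_ball.2 (hvi.trans (by linarith))
  have hvim : (p i).im < ((δ : ℂ) * hexCenter v).im := im_lt_of_flat (hfl i) hvball hvΩ
  -- the starting vertex is lower than the up-faces of row `m i`
  have hvlt : ((δ : ℂ) * hexCenter v).im < ((m i : ℝ) + 1 / 3) * (δ * (Real.sqrt 3 / 2)) := by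
    by_contra hge
    push Not at hge
    exact (not_le.2 hrow) ((row_le_iff_im hδ (m i) v).2 hge)
  set L : ℝ := ((δ : ℂ) * hexCenter v).im - ((p i).im - ρ / 8) + δ with hL
  have hL0 : 0 ≤ L := by rw [hL]; linarith
  have hLle : L ≤ ρ / 16 + ρ / 8 + δ := by rw [hL]; linarith [hm i]
  obtain ⟨w₀, q, hw₀, hq⟩ := exists_walk_down hδ v hL0
  have hw₀im : ((δ : ℂ) * hexCenter w₀).im ≤ (p i).im - ρ / 8 := by rw [hL] at hw₀; linarith
  have hmem : ∀ u ∈ q.support, (δ : ℂ) * hexCenter u ∈ ball (p i) (ρ / 2) ∧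
      ((δ : ℂ) * hexCenter u).im ≤ ((δ : ℂ) * hexCenter v).im := by
    intro u hu
    obtain ⟨h1, h2⟩ := hq u hu
    refine ⟨mem_ball.2 ?_, h1⟩
    calc dist ((δ : ℂ) * hexCenter u) (p i)
        ≤ dist ((δ : ℂ) * hexCenter u) ((δ : ℂ) * hexCenter v) + dist ((δ : ℂ) * hexCenter v) (p i) :=
          dist_triangle _ _ _
      _ < 2 * L + ρ / 16 := add_lt_add_of_le_of_lt h2 hvi
      _ ≤ ρ / 2 := by linarith
  have hvw₀ : PathIn hexGraph Sᶜ v w₀ := by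
    refine pathIn_of_walk q fun u hu huS => ?_
    obtain ⟨hub, huim⟩ := hmem u hu
    have hrowu : m i ≤ u.1 1 := hSrow u huS i hub
    have := (row_le_iff_im hδ (m i) u).1 hrowu
    linarith
  obtain ⟨hw₀b, -⟩ := hmem w₀ q.end_mem_support
  have hw₀b' : (δ : ℂ) * hexCenter w₀ ∈ ball (p i) ρ := ball_subset_ball (by linarith) hw₀b
  have heE : (δ : ℂ) * hexCenter w₀ ∉ closure Ω :=
    not_mem_closure_of_flat (hfl i) hw₀b' (by linarith)
  have hlow : ∀ j, dist ((δ : ℂ) * hexCenter w₀) (p j) < 7 * ρ / 10 →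
      ((δ : ℂ) * hexCenter w₀).im ≤ (p j).im - ρ / 8 := by
    intro j hj
    by_cases hij : i = j
    · subst hij; exact hw₀im
    · exfalso
      have := hsep' i j hij
      have : dist (p i) (p j) ≤ dist ((δ : ℂ) * hexCenter w₀) (p i) + dist ((δ : ℂ) * hexCenter w₀) (p j) :=
        dist_triangle_left _ _ _
      have := mem_ball.1 hw₀b'
      linarith
  obtain ⟨w, hw, hp⟩ := exists_pathIn_far_of_low hE hΩR hfl hsep hρ hδ hδρ hS heE hlow (z₁ := w₀)
    (by rw [dist_self]; positivity)
  exact ⟨w, hw, hvw₀.trans hp⟩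

/-- **Registered sub-goal `stub_carvedReduction_twoPieceEscape`** (crux item stmt-CriticalPhenomena-14005,
stub 5a4′ `stub_carvedReduction_squeeze`, piece (G4′b) ESCAPE ROUTES OF A TWO-PIECE FLAT DOMAIN):
registry form of `exists_pathIn_far_of_not_mem` and `exists_pathIn_far_of_row_lt` together. -/
theorem stub_carvedReduction_twoPieceEscape :
    ∀ (Ω : Set ℂ) (ρ δ R : ℝ) (p : Fin 2 → ℂ) (m : Fin 2 → ℤ) (S : Set HexVertex),
      IsConnected (closure Ω)ᶜ → frontier (closure Ω)ᶜ = frontier Ω → (∀ z ∈ Ω, ‖z‖ < R) →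
      (∀ i, Ω ∩ ball (p i) ρ = {z : ℂ | (p i).im < z.im} ∩ ball (p i) ρ) →
      2 * ρ ≤ dist (p 0) (p 1) → 0 < ρ → 0 < δ → 1000 * δ ≤ ρ →
      (∀ i, ((m i : ℝ) + 1 / 3) * (δ * (Real.sqrt 3 / 2)) ≤ (p i).im + ρ / 16) →
      (∀ u ∈ S, (δ : ℂ) * hexCenter u ∈ Ω ∧
        closedBall ((δ : ℂ) * hexCenter u) (70 * δ) ⊆ Ω ∪ ball (p 0) (5 * ρ / 8) ∪ ball (p 1) (5 * ρ / 8)) →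
      (∀ u ∈ S, ∀ i, (δ : ℂ) * hexCenter u ∈ ball (p i) (ρ / 2) → m i ≤ u.1 1) →
      ∀ v : HexVertex,
        ((δ : ℂ) * hexCenter v ∉ Ω ∨ ∃ i, dist ((δ : ℂ) * hexCenter v) (p i) < ρ / 16 ∧ v.1 1 < m i) →
        ∃ w : HexVertex, R + ρ + 5 * δ ≤ ‖(δ : ℂ) * hexCenter w‖ ∧ PathIn hexGraph Sᶜ v w := by
  intro Ω ρ δ R p m S hE hEfr hΩR hfl hsep hρ hδ hδρ hm hS hSrow v hv
  rcases hv with hv | ⟨i, hvi, hrow⟩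
  · exact exists_pathIn_far_of_not_mem hE hEfr hΩR hfl hsep hρ hδ hδρ hS hv
  · exact exists_pathIn_far_of_row_lt hE hEfr hΩR hfl hsep hρ hδ hδρ hm hS hSrow hvi hrow

end Summit.CriticalPhenomena.SAWScalingLimit.Theorems.ObservableToSLER.Squeeze

end
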